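import Summits.QuantumFields.YangMills.Theses.ThermalRuler

/-!
# Route ThermalRuler — the assembly `Assembly` (item stmt-QuantumFields-9025)

Route `route-QuantumFields-ThermalRuler` (sub-problem `YangMills` of summit `QuantumFields`) files,
as its assembly item `Assembly` (stmt-QuantumFields-9025, rank 1), the implication chain

  `ThermalRulerBound → RulerSoftens → SofteningCentreBlind → StrongGapSeqAllG →
   ContinuumFromMixing → YangMills`.

This is, verbatim, the curried type of the route's deciding theorem
`Summit.QuantumFields.YangMills.Theses.ThermalRuler.closes` (planner-authored, sorry-free,
kernel-checked with the route file). Its content is pure logic: for a compact simple Lie `G`,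
`StrongGapSeqAllG` supplies a faithful lattice representation `r` and couplings `b_k → ∞` with
strong-decay rates `m_k ∈ (0,1]`; a classical case split on whether some central `z` acts in `r` by a
scalar `ω ≠ 1` gives softening `m_k → 0` either from `RulerSoftens` (fed with `ThermalRulerBound`)
or from `SofteningCentreBlind`; `ContinuumFromMixing` then yields the Clay clause of `YangMills` at
`G` for the witness `r`. This file closes the item by that definitional unfolding; it adds no
mathematics of its own.

Sources: route-internal (the deciding theorem `closes`); Jaffe–Witten 2000 for the clauses packaged
in `YangMills`; Borgs–Seiler 1983 and Chatterjee 2021 for the ruler mechanism behind the cruxes.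
Deliberately NOT here: the target `ThermalRulerBound`, the cruxes (`QuantCentreRestoration`,
`TorusToStrong`, `ContinuumFromMixing`, `StrongGapSeqAllG`, `SofteningCentreBlind`) and the supports
(`LinearDeconfinementWindow`, `RulerSoftens`) — they stay items of the route.
-/

namespace Summit.QuantumFields.YangMills.Theorems

/-- **`ThermalRuler.Assembly` holds** (assembly item stmt-QuantumFields-9025): the chain
`ThermalRulerBound → RulerSoftens → SofteningCentreBlind → StrongGapSeqAllG → ContinuumFromMixing →
YangMills`.
Proof: after unfolding, the goal is literally the type of the route's sorry-free deciding theorem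
`ThermalRuler.closes` (`StrongGapSeqAllG` supplies `(r, b, m)`; softening of `m` from `RulerSoftens`
or `SofteningCentreBlind` by a classical case split on a centre-charged scalar; `ContinuumFromMixing`
concludes). [folklore] -/
theorem thermalRuler_assembly_proof :
    Summit.QuantumFields.YangMills.Theses.ThermalRuler.Assembly := by
  unfold Summit.QuantumFields.YangMills.Theses.ThermalRuler.Assembly
  exact Summit.QuantumFields.YangMills.Theses.ThermalRuler.closes

end Summit.QuantumFields.YangMills.Theorems
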